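import Summits.BirchSwinnertonDyer.Rank1Residual.Supersingular.X6VisibilityTamDefectRecords
import Summits.BirchSwinnertonDyer.Rank1Residual.Supersingular.ShaAnOfLOneBall
import Summits.BirchSwinnertonDyer.Rank1Residual.Supersingular.RationalLadder
import Summits.BirchSwinnertonDyer.Rank1Residual.GaloisImage.PadicTwistClassDecider
import Literature.NumberTheory.GaloisRepresentations.LocalH2VanishingTrivialModule
import Summits.BirchSwinnertonDyer.Rank1Residual.Additive.ZpTowerLayerRootsOfUnity
import Literature.NumberTheory.EllipticCurves.Rank1Residual.AnomalousDictionaryProofs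
import Summits.BirchSwinnertonDyer.Rank1Residual.Supersingular.X6VisibilityTamDefectL1CertRecords
import HarnessLib

/-!
# X6 (N4 TAM-DEFECT / five-kind) rank-0 VISIBILITY offers with the CREMONA binders `r_an = 0`, `#Ш_an = q`, `ord_p q ≤ 2` REPLACED BY `hball0` + kernel arithmetic AND the kind-(iii) LOCAL binders PROVED (square class + μ_p decided) — second-layer twins of `X6VisibilityTamDefectRecords.lean` (`22678e1`@`5`, `22678e1`@`5`)
# (the landed offer minus `hr0`/`hq`/`hv` and minus its kind-(iii) binders `hℓ`; plus `f`/`hf`, `hϖ`, `hball0`; tools: `ShaAnOfLOneBall`, n1011's `PadicTwistClassDecider`, `adicCompletion_pow_eq_one_imp`)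

Cell `b2b-bsdres`, supersingular family, prover A = unit `b2b-bsdres-x10b` (gen 22).  THEOREMS ONLY: each theorem re-derives the source's
integral model and class line, obtains `(hr0, q, hq, hv)` from `Supersingular/ShaAnOfLOneBall.lean`, PROVES every kind-(iii) local binder of the source
(`∃ r, ι(−c₄/c₆)(E) = r²·ι(−c₄/c₆)(F)` by `exists_eq_sq_mul_of_sqFlagAt` on `N/D` read off the models; `μ_p(ℚ_v) = 1` by `adicCompletion_pow_eq_one_imp`, `N(v) = ℓ ≢ 1 (mod p)`)
and ends with ONE `exact` on the landed source theorem; no definition, no named fact, nothing booked.  Pattern of gen 21's `…RanL1Cert…` files (the `r_an = 0` binder of the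
Kurihara offers from the same level-one enclosure): here the visibility offers lose ALL THREE table binders of the target —
`r_an = 0`, `#Ш_an = q ∈ ℚ` and `ord_p q ≤ 2` (Cremona `allbsd`) — in favour of the engine's certified `T₀ = L(E,1)/ω₁ = I/den`
(job j202394: engine `impl3d-kurtw-seg/2026-08-22-g13-v2k` UNCHANGED — gen13/segk bytes — on the 17 visibility targets, 17/17 `T0_cert` certified, margins `≤ 4.1·10⁻³¹`,
radii `≤ 9.5·10⁻²⁸`, displayed with the uniform bounds `10⁻²⁰`; the run's small level prime is not used) and KERNEL arithmetic:
`[0]⁺_f = I/(den·c_∞)` EXACTLY (rounding lemma, `den [0]⁺_f ∣ 2#Ẽ(𝔽_p) ≤ 8p`), `L(E,1) = Ω⁺_f·[0]⁺_f`, `Ω(W) = u·Ω⁺_f` with `|u|_p = 1` (`hϖ`: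
Greenberg–Vatsal Rem. 3.4 + Manin constant, the period binder of every Kurihara offer), `Reg = 1`, `p ∤ #E(ℚ)_tors` (good supersingular ⇒
irreducible), `∏ c_ℓ` EXACT by a Tate-algorithm row certificate of the literal model (`TamZ.rowCheckZ`, `decide +kernel`; certificates by
`HOME/b2b-bsdres-n1011-p03/tools/tamcert.py` = the rank-2 observatory's engine 1, UNCHANGED; the kernel re-verifies every row) ⇒
`#Ш_an = (I/(den c_∞))·#E(ℚ)_tors²/(u·∏c_ℓ) ∈ ℚ` with `ord_p #Ш_an = ord_p I − ord_p(den·c_∞·∏c_ℓ) = 2` (two `decide`s).  What stays outside the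
kernel: the ball itself and the identification `Ω⁺_f = c_∞·ω₁` (optimal curve, Manin constant `1`) — as for every `hball0`/`hballL` consumer.
Generator `HOME/b2b-bsdres-x10b/gen22/code/gen_visl1.py`; data `gen22/T0-vis-g22.json`, `gen22/tamcert_g22.json`; X6-KURIHARA.md §22 / X7-KURIHARA.md §25.

ALSO (x10b gen 22): the partner-rank binder `hrank : 2 ≤ rank F(ℚ)` of these records is DISCHARGED in the kernel by a RED-pair certificate
(tree checker `two_le_mordellWeilRank_of_redPair`, `RationalPointRankTwoCriteria.lean`; multiples by the division-free ℚ-ladder `RationalLadder.lean`,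
`decide +kernel`; generator = gen16's `mkrecord.rank2_block` UNCHANGED; certificates `gen22/redpair_g22.json` from Cremona's `allgens` / gen-15 generators):
`c430882i1`: m = 3, ℓ₀ = 11 (N = 16), rows [[0, 3, 3], [1, 5, 6], [2, 3, 3]], Q at [3, 3]

HONEST FRAMING (run/shared/lean/b2b/bsd-rank1-residual/, verbatim in every file): the goal of the
cell is to DELETE the COMBINATION-SHAPED residual classes of the Birch–Swinnerton-Dyer formula for
ALL analytic-rank `≤ 1` elliptic curves over `ℚ` — "full BSD formula for every rank `≤ 1` curve in
class `C`" assembled STRICTLY from published theorems — so that the rank-`≤ 1` remainder becomes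
exactly the CONSTRUCTION-SHAPED classes, which are TYPED (missing-input `Prop`s), NOT attempted.
This is not "finishing BSD".  Classes X6 / X7 stay CONSTRUCTION-SHAPED (RESIDUAL-MAP §I N4 / N5); PER-PAIR OFFERS, nothing booked.

References: [Wuthrich2014] Prop. 21; [CremonaMazur2000] §3; [Fisher2016Visualizing7] Thm. 4.4; [Fisher2012Hessian] Thm. 13.2;
[MazurTateTeitelbaum1986Invent] §I.8; [GreenbergVatsal2000] §3 Rem. 3.4; [Silverman1994] IV.9.4; [Miller2011LMS] Def. 1.1; [Cremona2006] Table 1.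
-/

set_option autoImplicit false

noncomputable section

open scoped Classical MatrixGroups ModularForm

open CongruenceSubgroup WeierstrassCurve Literature.NumberTheory.EllipticCurves
  Literature.NumberTheory.EllipticCurves.Rank1Residual
  Literature.NumberTheory.EllipticCurves.Rank1Residual.Typed
  Literature.NumberTheory.EllipticCurves.Rank1Residual.X11RankOneCertificates
  Literature.NumberTheory.EllipticCurves.Wuthrich2014
  Literature.NumberTheory.EllipticCurves.Fisher2016
  Literature.NumberTheory.EllipticCurves.Fisher2012
  Summit.BirchSwinnertonDyer.BirchSwinnertonDyer.Rank1Residual.IntModel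
  Summit.BirchSwinnertonDyer.Rank1Residual.X11b
  Literature.NumberTheory.EllipticCurves.ModularForms
  Summit.BirchSwinnertonDyer.BirchSwinnertonDyer.Rank2Observatory.Tam
open NumberField IsDedekindDomain Rat.HeightOneSpectrum
open Summit.BirchSwinnertonDyer.Rank1Residual.GaloisImage.LocalTorsion3At (exists_eq_sq_mul_of_sqFlagAt)

namespace Summit.BirchSwinnertonDyer.Rank1Residual.Supersingular

/-- **`BSD(E,5)` for `22678e1`, OFFERED — the three CREMONA binders `r_an = 0`, `#Ш_an = q`, `ord_5 q ≤ 2` of the landed visibility offer REPLACED BY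
THE ENGINE'S LEVEL-ONE ENCLOSURE + KERNEL ARITHMETIC.**  Exactly the landed `bsdp_x6r0vis_22678e1_5_of_congr` (`X6VisibilityTamDefectRecords.lean`;
the `5`-congruence a displayed binder `θ`/`hθ`) minus `hr0`, `hq`, `hv`, plus the newform `f` of `W` (`hf`), the period comparison `hϖ` (`Ω(W) =
u·Ω⁺_f`, `|u|_5 = 1`) and `hball0` — the engine's certified `T₀ = L(E,1)/ω₁ = 1250/3` (`I = 1250`, `den = 3`, `c_∞ = 1`; job j202394,
`impl3d-kurtw-seg/2026-08-22-g13-v2k` UNCHANGED, margin `4.09e-31`, radius `4.7e-28`; the run's level `11` is not used) —; the triple `(hr0, hq, hv)`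
is then the tool theorem `analyticRank_shaAn_of_LOneBall_of_rowCheckZ` (`Supersingular/ShaAnOfLOneBall.lean`: `[0]⁺_f = I/(den·c_∞)` exactly by the
rounding lemma at the good prime `5`, `L(E,1) = Ω⁺_f·[0]⁺_f`, `Reg = 1`, `5 ∤ #E(ℚ)_tors`, `ord_5 u = 0`) fed with the Tate-algorithm ROW CERTIFICATE
of the model (`decide +kernel`; `2`: `In` (`n = 75`), `c = 75`; `17`: `In` (`n = 1`), `c = 1`; `23`: `In` (`n = 1`), `c = 1`; `29`: `In` (`n = 4`), `c
= 2`; `∏ c_ℓ = 150`): `5^2 ∣ den·c_∞·∏c` and `5^5 ∤ I` (`decide`), so `ord_5 #Ш_an = 4 − 2 = 2`.  ALSO the partner's rank binder `hrank : 2 ≤ rank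
F(ℚ)` is DISCHARGED in the kernel (`two_le_rank_c430882i1` above: RED-pair certificate, m = 3, tree checker `two_le_mordellWeilRank_of_redPair` + the
ℚ-ladder).  SECOND LAYER (x10b gen 22): ALSO the kind-(iii) local binders at the place(s) 2, 29 (both curves multiplicative there) are PROVED in the
kernel — `γ(E)/γ(F) = −(c₄/c₆)(E)/−(c₄/c₆)(F) = N/D` (`N = -16793308062978907565`, `D = 16404306232503936858787`, by `norm_num` from the two models)
is a square in `ℚ_v` by n1011's decider `exists_eq_sq_mul_of_sqFlagAt` (`sqFlagAt`, `decide +kernel`; valuation 0, unit part a quadratic residue) and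
`μ_5(ℚ_v) = 1` by `adicCompletion_pow_eq_one_imp` (`v ∤ 5`, `N(v) = ℓ ≢ 1 (mod 5)`); binders left: named facts + hϖ, f/hf, hball0, the partner's
kind-(i)/(ii) local data [θ/hθ].  (Layer-1 text:) BINDERS LEFT: the named facts of the source + `hϖ`; the newform `f` (`hf`); `hball0`; the partner's
data as in the source — and NO table entry for the target.  Per pair (an OFFER for referee A); NOT a class theorem; nothing booked.
[cite: Wuthrich2014, Prop. 21 (p. 400)] [cite: CremonaMazur2000, §3 and Table 1]
[cite: Miller2011LMS, Def. 1.1 (arXiv:1010.2431 p. 3)] [cite: Cremona2006, Table 1 (Cremona label 22678e1)] [cite: SilvermanATAEC1994, V.5.3] [cite: NeukirchANT1999, II §5 Prop. (5.3) and (5.7)] -/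
theorem bsdp_x6r0visbl_22678e1_5_of_congr
    (hCT : exists_casselsTate_pairing (K := ℚ)) (hW : sha_dvd_analyticSha)
    (hGZK : rank_eq_analyticRank_of_analyticRank_le_one) (hmod : hasEntireLFunction_rat)
    (hϖ : realPeriodRat_eq_unit_mul_plusPeriod)
    (hU : Silverman1994_thmV53_tateUniformisation.{0})
    (hU2 : Silverman1994_thmV53_corV54_tateUniformisation.{0})
    (hF44 : thm44_selmerLocalKer_iff_of_nonsplit_good)
    {W F : WeierstrassCurve ℚ} [W.IsElliptic] [W.IsGloballyMinimal] [F.IsElliptic] [F.IsGloballyMinimal]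
    (hWeq : W = ⟨1, 0, 0, 3140254662, -139987982322460⟩) (hFeq : F = ⟨1, 0, 0, -14128, -645920⟩)
    -- the engine's LEVEL-ONE ENCLOSURE of T₀ = L(E,1)/ω₁ (job j202394; replaces the Cremona data r_an = 0, #Ш_an of the source)
    {N : ℕ} [NeZero N] (f : CuspForm (Gamma0 N) 2) (hf : IsNewformOf W f)
    (hball0 : ∃ mid rad : ℝ, rad ≤ 1 / 10 ^ (20 : ℕ) ∧ |mid - ((1250 : ℤ) : ℝ)| ≤ 1 / 10 ^ (20 : ℕ) ∧
      |((3 : ℕ) : ℝ) * (((1 : ℕ) : ℝ) * ((W.entireLFunction 1).re / plusPeriod f)) - mid| ≤ rad)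
    -- the 5-congruence (displayed binder in this form; the Hesse-certificate form below DISCHARGES it)
    (θ : geomTorsion F (5 : ℤ) ≃+ geomTorsion W (5 : ℤ))
    (hθ : ∀ (σ : Field.absoluteGaloisGroup ℚ) (P : geomTorsion F (5 : ℤ)), θ (σ • P) = σ • θ P)
    -- local data of the partner / the pair (displayed binders)
    (h5 : ∀ w : HeightOneSpectrum (𝓞 ℚ), (primesEquiv w : ℕ) = 5 →
      Nat.card (nsmulAddMonoidHom 5 : (F.baseChange (w.adicCompletion ℚ)).toAffine.Point →+ _).ker = 1)
    (h17 : ∀ w : HeightOneSpectrum (𝓞 ℚ), (primesEquiv w : ℕ) = 17 →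
      Nat.card (nsmulAddMonoidHom 5 : (F.baseChange (w.adicCompletion ℚ)).toAffine.Point →+ _).ker = 1)
    (h23 : ∀ w : HeightOneSpectrum (𝓞 ℚ), (primesEquiv w : ℕ) = 23 →
      Nat.card (nsmulAddMonoidHom 5 : (F.baseChange (w.adicCompletion ℚ)).toAffine.Point →+ _).ker = 1) :
    BSDp W 5 := by
  haveI : Fact (Nat.Prime 5) := ⟨by norm_num⟩
  have hIW : integralModelInt W = ⟨1, 0, 0, 3140254662, -139987982322460⟩ :=
    integralModelInt_eq_of_map_eq _ (by rw [hWeq]; ext <;> simp [WeierstrassCurve.map])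
  have hX : ClassX6 W 5 :=
    classX6_of_intModel 5 le_rfl hIW (by decide +kernel) card_c22678e1_5 (by decide) (by decide +kernel)
  obtain ⟨hr0, q, hq, hv⟩ := analyticRank_shaAn_of_LOneBall_of_rowCheckZ hϖ hGZK W 5 (by norm_num) hX.1 f hf
    _ _ 3 1 (by norm_num) 1250 (by norm_num) hball0 hIW
    (Es := [⟨2, 1, 1, 0, 0, 0, 0, 75, 0, 0, 75⟩, ⟨17, 4, 3, 0, 0, 0, 0, 1, 0, 0, 1⟩, ⟨23, 4, 3, 0, 0, 0, 0, 1, 0, 0, 1⟩, ⟨29, 5, 3, 0, 0, 0, 0, 4, 0, 0, 2⟩]) (Xs := [])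
    (Zs := []) (by decide +kernel) (by decide +kernel) 2 2 (by decide +kernel) (by decide)
  have hrank : 2 ≤ F.mordellWeilRank := by rw [hFeq]; exact two_le_rank_c430882i1
  have hc4 : W.c₄ = (-150732223775 : ℚ) := by
    subst hWeq; norm_num [WeierstrassCurve.c₄, WeierstrassCurve.b₂, WeierstrassCurve.b₄]
  have hc6 : W.c₆ = (120949842824941103 : ℚ) := by
    subst hWeq; norm_num [WeierstrassCurve.c₆, WeierstrassCurve.b₂, WeierstrassCurve.b₄, WeierstrassCurve.b₆]
  have hc4F : F.c₄ = (678145 : ℚ) := by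
    subst hFeq; norm_num [WeierstrassCurve.c₄, WeierstrassCurve.b₂, WeierstrassCurve.b₄]
  have hc6F : F.c₆ = (557057663 : ℚ) := by
    subst hFeq; norm_num [WeierstrassCurve.c₆, WeierstrassCurve.b₂, WeierstrassCurve.b₄, WeierstrassCurve.b₆]
  -- kind (iii) at 2: γ(E)/γ(F) = N/D with N·D an 2-adic square (v_2 = 0, `sqFlagAt` true) and μ_5(ℚ_2) = 1 (2 ≢ 1 mod 5) — both DECIDED
  have h2 : ∀ w : HeightOneSpectrum (𝓞 ℚ), (primesEquiv w : ℕ) = 2 →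
      (∃ r : w.adicCompletion ℚ, algebraMap ℚ (w.adicCompletion ℚ) (-(W.c₄ / W.c₆)) =
          r ^ 2 * algebraMap ℚ (w.adicCompletion ℚ) (-(F.c₄ / F.c₆))) ∧
        (∀ ζ : w.adicCompletion ℚ, ζ ^ 5 = 1 → ζ = 1) := by
    intro w hw
    haveI : Fact (Nat.Prime 2) := ⟨by norm_num⟩
    refine ⟨?_, Literature.NumberTheory.GaloisRepresentations.adicCompletion_pow_eq_one_imp w
      (natCast_not_mem_of_primesEquiv_ne w (Fact.out : Nat.Prime 5) (by rw [hw]; decide))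
      (by rw [Summit.BirchSwinnertonDyer.Rank1Residual.Additive.ZpTower.residueCard_eq_of_prime_mem (by norm_num : Nat.Prime 2)
        (Literature.NumberTheory.EllipticCurves.Rank1Residual.natCast_mem_asIdeal_of_primesEquiv_eq hw)]; decide)⟩
    rw [hc4, hc6, hc4F, hc6F]
    exact exists_eq_sq_mul_of_sqFlagAt w hw (N := -16793308062978907565) (D := 16404306232503936858787) (by norm_num) (by norm_num) (by norm_num)
      (w := 0) (by norm_num) (by norm_num) (by decide +kernel)
  -- kind (iii) at 29: γ(E)/γ(F) = N/D with N·D an 29-adic square (v_29 = 0, `sqFlagAt` true) and μ_5(ℚ_29) = 1 (29 ≢ 1 mod 5) — both DECIDED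
  have h29 : ∀ w : HeightOneSpectrum (𝓞 ℚ), (primesEquiv w : ℕ) = 29 →
      (∃ r : w.adicCompletion ℚ, algebraMap ℚ (w.adicCompletion ℚ) (-(W.c₄ / W.c₆)) =
          r ^ 2 * algebraMap ℚ (w.adicCompletion ℚ) (-(F.c₄ / F.c₆))) ∧
        (∀ ζ : w.adicCompletion ℚ, ζ ^ 5 = 1 → ζ = 1) := by
    intro w hw
    haveI : Fact (Nat.Prime 29) := ⟨by norm_num⟩
    refine ⟨?_, Literature.NumberTheory.GaloisRepresentations.adicCompletion_pow_eq_one_imp w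
      (natCast_not_mem_of_primesEquiv_ne w (Fact.out : Nat.Prime 5) (by rw [hw]; decide))
      (by rw [Summit.BirchSwinnertonDyer.Rank1Residual.Additive.ZpTower.residueCard_eq_of_prime_mem (by norm_num : Nat.Prime 29)
        (Literature.NumberTheory.EllipticCurves.Rank1Residual.natCast_mem_asIdeal_of_primesEquiv_eq hw)]; decide)⟩
    rw [hc4, hc6, hc4F, hc6F]
    exact exists_eq_sq_mul_of_sqFlagAt w hw (N := -16793308062978907565) (D := 16404306232503936858787) (by norm_num) (by norm_num) (by norm_num)
      (w := 0) (by norm_num) (by norm_num) (by decide +kernel)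
  exact bsdp_x6r0vis_22678e1_5_of_congr hCT hW hGZK hmod hU hU2 hF44 hWeq hFeq hr0 hq hv θ hθ hrank h5 h17 h23 h2 h29

/-- **`BSD(E,5)` for `22678e1`, OFFERED — the three CREMONA binders `r_an = 0`, `#Ш_an = q`, `ord_5 q ≤ 2` of the landed visibility offer REPLACED BY
THE ENGINE'S LEVEL-ONE ENCLOSURE + KERNEL ARITHMETIC.**  Exactly the landed `bsdp_x6r0vis_22678e1_5` (`X6VisibilityTamDefectRecords.lean`; the
`5`-congruence PROVED in the kernel from the Hesse certificate (Fisher 2012 Thm. 13.2 `hF13`)) minus `hr0`, `hq`, `hv`, plus the newform `f` of `W`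
(`hf`), the period comparison `hϖ` (`Ω(W) = u·Ω⁺_f`, `|u|_5 = 1`) and `hball0` — the engine's certified `T₀ = L(E,1)/ω₁ = 1250/3` (`I = 1250`, `den =
3`, `c_∞ = 1`; job j202394, `impl3d-kurtw-seg/2026-08-22-g13-v2k` UNCHANGED, margin `4.09e-31`, radius `4.7e-28`; the run's level `11` is not used) —;
the triple `(hr0, hq, hv)` is then the tool theorem `analyticRank_shaAn_of_LOneBall_of_rowCheckZ` (`Supersingular/ShaAnOfLOneBall.lean`: `[0]⁺_f =
I/(den·c_∞)` exactly by the rounding lemma at the good prime `5`, `L(E,1) = Ω⁺_f·[0]⁺_f`, `Reg = 1`, `5 ∤ #E(ℚ)_tors`, `ord_5 u = 0`) fed with the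
Tate-algorithm ROW CERTIFICATE of the model (`decide +kernel`; `2`: `In` (`n = 75`), `c = 75`; `17`: `In` (`n = 1`), `c = 1`; `23`: `In` (`n = 1`), `c
= 1`; `29`: `In` (`n = 4`), `c = 2`; `∏ c_ℓ = 150`): `5^2 ∣ den·c_∞·∏c` and `5^5 ∤ I` (`decide`), so `ord_5 #Ш_an = 4 − 2 = 2`.  ALSO the partner's
rank binder `hrank : 2 ≤ rank F(ℚ)` is DISCHARGED in the kernel (`two_le_rank_c430882i1` above: RED-pair certificate, m = 3, tree checker
`two_le_mordellWeilRank_of_redPair` + the ℚ-ladder).  SECOND LAYER (x10b gen 22): ALSO the kind-(iii) local binders at the place(s) 2, 29 (both curves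
multiplicative there) are PROVED in the kernel — `γ(E)/γ(F) = −(c₄/c₆)(E)/−(c₄/c₆)(F) = N/D` (`N = -16793308062978907565`, `D =
16404306232503936858787`, by `norm_num` from the two models) is a square in `ℚ_v` by n1011's decider `exists_eq_sq_mul_of_sqFlagAt` (`sqFlagAt`,
`decide +kernel`; valuation 0, unit part a quadratic residue) and `μ_5(ℚ_v) = 1` by `adicCompletion_pow_eq_one_imp` (`v ∤ 5`, `N(v) = ℓ ≢ 1 (mod 5)`);
binders left: named facts + hϖ, f/hf, hball0, the partner's kind-(i)/(ii) local data.  (Layer-1 text:) BINDERS LEFT: the named facts of the source +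
`hϖ`; the newform `f` (`hf`); `hball0`; the partner's data as in the source — and NO table entry for the target.  Per pair (an OFFER for referee A);
NOT a class theorem; nothing booked.
[cite: Wuthrich2014, Prop. 21 (p. 400)] [cite: CremonaMazur2000, §3 and Table 1]
[cite: Miller2011LMS, Def. 1.1 (arXiv:1010.2431 p. 3)] [cite: Cremona2006, Table 1 (Cremona label 22678e1)] [cite: SilvermanATAEC1994, V.5.3] [cite: NeukirchANT1999, II §5 Prop. (5.3) and (5.7)] -/
theorem bsdp_x6r0visbl_22678e1_5
    (hCT : exists_casselsTate_pairing (K := ℚ)) (hW : sha_dvd_analyticSha)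
    (hGZK : rank_eq_analyticRank_of_analyticRank_le_one) (hmod : hasEntireLFunction_rat)
    (hϖ : realPeriodRat_eq_unit_mul_plusPeriod)
    (hU : Silverman1994_thmV53_tateUniformisation.{0})
    (hU2 : Silverman1994_thmV53_corV54_tateUniformisation.{0})
    (hF44 : thm44_selmerLocalKer_iff_of_nonsplit_good) (hF13 : thm132_fiveCongruent_hessePencil)
    {W F : WeierstrassCurve ℚ} [W.IsElliptic] [W.IsGloballyMinimal] [F.IsElliptic] [F.IsGloballyMinimal]
    (hWeq : W = ⟨1, 0, 0, 3140254662, -139987982322460⟩) (hFeq : F = ⟨1, 0, 0, -14128, -645920⟩)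
    -- the engine's LEVEL-ONE ENCLOSURE of T₀ = L(E,1)/ω₁ (job j202394; replaces the Cremona data r_an = 0, #Ш_an of the source)
    {N : ℕ} [NeZero N] (f : CuspForm (Gamma0 N) 2) (hf : IsNewformOf W f)
    (hball0 : ∃ mid rad : ℝ, rad ≤ 1 / 10 ^ (20 : ℕ) ∧ |mid - ((1250 : ℤ) : ℝ)| ≤ 1 / 10 ^ (20 : ℕ) ∧
      |((3 : ℕ) : ℝ) * (((1 : ℕ) : ℝ) * ((W.entireLFunction 1).re / plusPeriod f)) - mid| ≤ rad)
    (h5 : ∀ w : HeightOneSpectrum (𝓞 ℚ), (primesEquiv w : ℕ) = 5 →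
      Nat.card (nsmulAddMonoidHom 5 : (F.baseChange (w.adicCompletion ℚ)).toAffine.Point →+ _).ker = 1)
    (h17 : ∀ w : HeightOneSpectrum (𝓞 ℚ), (primesEquiv w : ℕ) = 17 →
      Nat.card (nsmulAddMonoidHom 5 : (F.baseChange (w.adicCompletion ℚ)).toAffine.Point →+ _).ker = 1)
    (h23 : ∀ w : HeightOneSpectrum (𝓞 ℚ), (primesEquiv w : ℕ) = 23 →
      Nat.card (nsmulAddMonoidHom 5 : (F.baseChange (w.adicCompletion ℚ)).toAffine.Point →+ _).ker = 1) :
    BSDp W 5 := by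
  haveI : Fact (Nat.Prime 5) := ⟨by norm_num⟩
  have hIW : integralModelInt W = ⟨1, 0, 0, 3140254662, -139987982322460⟩ :=
    integralModelInt_eq_of_map_eq _ (by rw [hWeq]; ext <;> simp [WeierstrassCurve.map])
  have hX : ClassX6 W 5 :=
    classX6_of_intModel 5 le_rfl hIW (by decide +kernel) card_c22678e1_5 (by decide) (by decide +kernel)
  obtain ⟨hr0, q, hq, hv⟩ := analyticRank_shaAn_of_LOneBall_of_rowCheckZ hϖ hGZK W 5 (by norm_num) hX.1 f hf
    _ _ 3 1 (by norm_num) 1250 (by norm_num) hball0 hIW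
    (Es := [⟨2, 1, 1, 0, 0, 0, 0, 75, 0, 0, 75⟩, ⟨17, 4, 3, 0, 0, 0, 0, 1, 0, 0, 1⟩, ⟨23, 4, 3, 0, 0, 0, 0, 1, 0, 0, 1⟩, ⟨29, 5, 3, 0, 0, 0, 0, 4, 0, 0, 2⟩]) (Xs := [])
    (Zs := []) (by decide +kernel) (by decide +kernel) 2 2 (by decide +kernel) (by decide)
  have hrank : 2 ≤ F.mordellWeilRank := by rw [hFeq]; exact two_le_rank_c430882i1
  have hc4 : W.c₄ = (-150732223775 : ℚ) := by
    subst hWeq; norm_num [WeierstrassCurve.c₄, WeierstrassCurve.b₂, WeierstrassCurve.b₄]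
  have hc6 : W.c₆ = (120949842824941103 : ℚ) := by
    subst hWeq; norm_num [WeierstrassCurve.c₆, WeierstrassCurve.b₂, WeierstrassCurve.b₄, WeierstrassCurve.b₆]
  have hc4F : F.c₄ = (678145 : ℚ) := by
    subst hFeq; norm_num [WeierstrassCurve.c₄, WeierstrassCurve.b₂, WeierstrassCurve.b₄]
  have hc6F : F.c₆ = (557057663 : ℚ) := by
    subst hFeq; norm_num [WeierstrassCurve.c₆, WeierstrassCurve.b₂, WeierstrassCurve.b₄, WeierstrassCurve.b₆]
  -- kind (iii) at 2: γ(E)/γ(F) = N/D with N·D an 2-adic square (v_2 = 0, `sqFlagAt` true) and μ_5(ℚ_2) = 1 (2 ≢ 1 mod 5) — both DECIDED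
  have h2 : ∀ w : HeightOneSpectrum (𝓞 ℚ), (primesEquiv w : ℕ) = 2 →
      (∃ r : w.adicCompletion ℚ, algebraMap ℚ (w.adicCompletion ℚ) (-(W.c₄ / W.c₆)) =
          r ^ 2 * algebraMap ℚ (w.adicCompletion ℚ) (-(F.c₄ / F.c₆))) ∧
        (∀ ζ : w.adicCompletion ℚ, ζ ^ 5 = 1 → ζ = 1) := by
    intro w hw
    haveI : Fact (Nat.Prime 2) := ⟨by norm_num⟩
    refine ⟨?_, Literature.NumberTheory.GaloisRepresentations.adicCompletion_pow_eq_one_imp w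
      (natCast_not_mem_of_primesEquiv_ne w (Fact.out : Nat.Prime 5) (by rw [hw]; decide))
      (by rw [Summit.BirchSwinnertonDyer.Rank1Residual.Additive.ZpTower.residueCard_eq_of_prime_mem (by norm_num : Nat.Prime 2)
        (Literature.NumberTheory.EllipticCurves.Rank1Residual.natCast_mem_asIdeal_of_primesEquiv_eq hw)]; decide)⟩
    rw [hc4, hc6, hc4F, hc6F]
    exact exists_eq_sq_mul_of_sqFlagAt w hw (N := -16793308062978907565) (D := 16404306232503936858787) (by norm_num) (by norm_num) (by norm_num)
      (w := 0) (by norm_num) (by norm_num) (by decide +kernel)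
  -- kind (iii) at 29: γ(E)/γ(F) = N/D with N·D an 29-adic square (v_29 = 0, `sqFlagAt` true) and μ_5(ℚ_29) = 1 (29 ≢ 1 mod 5) — both DECIDED
  have h29 : ∀ w : HeightOneSpectrum (𝓞 ℚ), (primesEquiv w : ℕ) = 29 →
      (∃ r : w.adicCompletion ℚ, algebraMap ℚ (w.adicCompletion ℚ) (-(W.c₄ / W.c₆)) =
          r ^ 2 * algebraMap ℚ (w.adicCompletion ℚ) (-(F.c₄ / F.c₆))) ∧
        (∀ ζ : w.adicCompletion ℚ, ζ ^ 5 = 1 → ζ = 1) := by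
    intro w hw
    haveI : Fact (Nat.Prime 29) := ⟨by norm_num⟩
    refine ⟨?_, Literature.NumberTheory.GaloisRepresentations.adicCompletion_pow_eq_one_imp w
      (natCast_not_mem_of_primesEquiv_ne w (Fact.out : Nat.Prime 5) (by rw [hw]; decide))
      (by rw [Summit.BirchSwinnertonDyer.Rank1Residual.Additive.ZpTower.residueCard_eq_of_prime_mem (by norm_num : Nat.Prime 29)
        (Literature.NumberTheory.EllipticCurves.Rank1Residual.natCast_mem_asIdeal_of_primesEquiv_eq hw)]; decide)⟩
    rw [hc4, hc6, hc4F, hc6F]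
    exact exists_eq_sq_mul_of_sqFlagAt w hw (N := -16793308062978907565) (D := 16404306232503936858787) (by norm_num) (by norm_num) (by norm_num)
      (w := 0) (by norm_num) (by norm_num) (by decide +kernel)
  exact bsdp_x6r0vis_22678e1_5 hCT hW hGZK hmod hU hU2 hF44 hF13 hWeq hFeq hr0 hq hv hrank h5 h17 h23 h2 h29

end Summit.BirchSwinnertonDyer.Rank1Residual.Supersingular

end
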